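import Literature.Probability.Percolation.OneArmLSW
import HarnessLib

/-!
# Arm events confined to a domain; half-plane arm events and the universal half-plane two-arm bound

Topic `Literature/Probability/Percolation`; family `crit-perc`, statement **crit-perc.S16**
(`Literature.Probability.Percolation.triTheta_exponent`). The arm events *near a boundary* of
Kesten's near-critical theory (P. Nolin, *Near-critical percolation in two dimensions*, EJP 13
(2008), §4.6 "Arms in the half-plane": "we can define in the same way the event `B_{j,σ}(n, N)`
that there exist `j` arms that stay in the upper half-plane `ℍ`, of colors prescribed by `σ` and
connecting `∂S'_n` to `∂S'_N`, with the notation `∂S'_n = (∂S_n) ∩ ℍ`. These events appear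
naturally when we look at arms near a boundary"; W. Werner, PCMI 2009, Lecture 2, first exercise
sheet, "Two-arm exponent in the half-plane": arms that "stay in `x + H_n`",
`H_n = {z ∈ Λ_n : Im(z) ≥ 0}` the half-hexagon), and the universal value `1` of the half-plane
two-arm exponent, recorded as a named fact.

* `domArmEvent κ r R H` — the tree's `k`-arm event `armEvent κ r R` (`ArmEvents.lean`: `k`
  pairwise vertex-disjoint self-avoiding arms of colours `κ` across `Λ_R \ Λ_r`) with the arms
  moreover confined to the set of sites `H` (a *domain*: a half-plane, a box, …);
  `domArmEvent κ r R univ = armEvent κ r R` (`domArmEvent_univ`), `domArmEvent ⊆ armEvent`.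
* `upperHalfPlane = {z | 0 ≤ z₁}` — the closed upper half-plane of `𝕋` (the sites on or above the
  lattice line through `0` in the direction `e₀`, Werner's `{Im(z) ≥ 0}`), so that
  `domArmEvent κ r R upperHalfPlane` is Nolin's `B_{k,κ}(r, R)` (hexagons for rhombi, as
  everywhere in this library; the cyclic — here linear — order of the arms is not imposed, as in
  `armEvent`).
* API: `mem_domArmEvent_of_pathIn` (arms given as `PathIn`-paths in disjoint monochromatic
  subsets of the annulus inside `H`), `domArmEvent_mono_dom`, `isLowerSet_domArmEvent` (closed
  arms form a decreasing event), `isUpperSet_domArmEvent`, `determinedBy_domArmEvent` (by the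
  annulus), `measurableSet_domArmEvent`, `mem_domArmEvent_of_relabel_iso` /
  `relabel_iso_mem_domArmEvent_iff` (transport under the automorphisms of `𝕋` preserving the
  graph norm: the domain is transported along), `real_domArmEvent_relabel_iso` (hence equal
  probabilities for a domain and its image).
* `Nolin2008_halfPlane_twoArm` (named fact) — **the half-plane two-arm probability at `p = 1/2`
  is at most `cst · m/n`**, for every colour pair: Nolin 2008, Thm. 24 (i) [arXiv 0711.4948:
  Thm. 23 (i)]: "For any `σ ∈ 𝔖₂`, `P_{1/2}(B_{2,σ}(0, N)) ≍ N^{-1}`", in the two-radii form given by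
  quasi-multiplicativity (Prop. 17 [arXiv: Prop. 16], which "remain[s] true for arms in the
  half-plane", §4.6); Werner 2009, first exercise sheet (`c₁/n ≤ w_n ≤ c₂/n`) and Lecture 6, §3
  ("uniform estimates for the probabilities of existence … of two-arms in the half-plane");
  Smirnov–Werner 2001, §4, Thm. 3 (`j(j+1)/6 = 1` for `j = 2`). Only the upper bound is recorded.

Design. `H` is a plain `Set (Site 2)` rather than a structure, so that translated and rotated
half-planes, boxes and wedges are all instances; the transport lemma moves `H` by the
automorphism. The six half-planes of `𝕋` bounded by lattice lines through `0` are the images of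
`upperHalfPlane` under the rotation `triRotIso` and its powers.

## References

* P. Nolin, Near-critical percolation in two dimensions, *Electron. J. Probab.* 13 (2008), §4.6;
  Thm. 24 (i); Prop. 17 [arXiv 0711.4948: Thm. 23 (i), Prop. 16] [Nolin2008].
* W. Werner, *Lectures on two-dimensional critical percolation*, IAS/Park City Math. Ser. 16
  (2009), Lecture 2, first exercise sheet ("Two-arm exponent in the half-plane") and Lecture 6,
  §3 [WernerPCMI2009].
* S. Smirnov, W. Werner, Critical exponents for two-dimensional percolation, *Math. Res. Lett.*
  8 (2001), §4, Thm. 3 [SmirnovWernerMRL2001].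
* H. Kesten, Scaling relations for 2D-percolation, *Comm. Math. Phys.* 109 (1987)
  [KestenScalingCMP1987].

Tree: `armEvent`, `IsColouredPath` (`ArmEvents.lean`), `triAnnulus`, `mem_triAnnulus_of_arm`
(`ArmEventsProofs.lean`), `mem_armEvent_of_pathIn` (`ParaPivotalArms.lean`, the model of
`mem_domArmEvent_of_pathIn`; not imported), `PathIn.exists_walk` (`OneArmLSW.lean`),
`sitePercolation_real_preimage_relabel` (`SitePercolationMeasure.lean`),
`DeterminedBy.measurableSet_of_finset` (`PercolationEvents.lean`).
-/

noncomputable section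

open MeasureTheory Set

namespace Literature.Probability.Percolation

open LatticeModels

/-! ### Arm events confined to a domain -/

/-- **Arms confined to a domain.** The `k`-arm event with colour sequence `κ` in the annulus
`Λ_R \ Λ_r` of `𝕋` *inside the set of sites `H`*: there are `k` self-avoiding paths, the `j`-th
from a site of `∂Λ_r` to a site of `∂Λ_R`, all of whose sites lie in `((Λ_R \ Λ_r) ∪ ∂Λ_r) ∩ H`,
monochromatic of colour `κ j`, and pairwise vertex-disjoint — the tree's `armEvent κ r R` with the
arms moreover required to stay in `H` (Nolin 2008, §4.6: arms "that stay in the upper half-plane";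
Werner 2009, exercise sheet: arms that "stay in `x + H_n`"). As in `armEvent`, the cyclic (for a
half-plane: linear) order of the arms is not imposed. [cite: Nolin2008, §4.6 (arms in the half-plane, B_{j,σ}(n,N))] -/
def domArmEvent {k : ℕ} (κ : Fin k → Bool) (r R : ℕ) (H : Set (Site 2)) :
    Set (SiteConfig (Site 2)) :=
  {ω | ∃ (x y : Fin k → Site 2) (w : ∀ j, triGraph.Walk (x j) (y j)),
    (∀ j, x j ∈ triSphere r ∧ y j ∈ triSphere R ∧ (w j).IsPath ∧
      (∀ v ∈ (w j).support,
        (v ∈ (↑(triBall R) : Set (Site 2)) \ ↑(triBall r) ∨ v ∈ triSphere r) ∧ v ∈ H) ∧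
      IsColouredPath ω (κ j) (w j)) ∧
    Pairwise fun i j => Disjoint (w i).support.toFinset (w j).support.toFinset}

/-- The **closed upper half-plane** of `𝕋`: the sites on or above the lattice line through the
origin in the direction `e₀` (`{Im(z) ≥ 0}` in the equilateral embedding, Werner's `H_n` without
the size restriction; Nolin's `ℍ`). [cite: WernerPCMI2009, Lecture 2, first exercise sheet (H_n = {z ∈ Λ_n : Im z ≥ 0})] -/
def upperHalfPlane : Set (Site 2) := {z | 0 ≤ z 1}

/-- Membership in `upperHalfPlane`, unfolded. [cite: WernerPCMI2009, Lecture 2, first exercise sheet] -/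
@[simp] theorem mem_upperHalfPlane {z : Site 2} : z ∈ upperHalfPlane ↔ 0 ≤ z 1 := Iff.rfl

section API

variable {k : ℕ} (κ : Fin k → Bool) {r R : ℕ} {H H' : Set (Site 2)}

/-- Arms confined to `H` are arms. [cite: Nolin2008, §4.6] -/
theorem domArmEvent_subset_armEvent (r R : ℕ) (H : Set (Site 2)) :
    domArmEvent κ r R H ⊆ armEvent κ r R := by
  rintro ω ⟨x, y, w, hw, hd⟩
  exact ⟨x, y, w, fun j => ⟨(hw j).1, (hw j).2.1, (hw j).2.2.1, fun v hv => ((hw j).2.2.2.1 v hv).1,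
    (hw j).2.2.2.2⟩, hd⟩

/-- Arms confined to the whole plane are just arms. [cite: Nolin2008, §4.6] -/
theorem domArmEvent_univ (r R : ℕ) : domArmEvent κ r R univ = armEvent κ r R := by
  refine Subset.antisymm (domArmEvent_subset_armEvent κ r R univ) ?_
  rintro ω ⟨x, y, w, hw, hd⟩
  exact ⟨x, y, w, fun j => ⟨(hw j).1, (hw j).2.1, (hw j).2.2.1,
    fun v hv => ⟨(hw j).2.2.2.1 v hv, mem_univ v⟩, (hw j).2.2.2.2⟩, hd⟩

/-- The confined arm event is monotone in the domain. [cite: Nolin2008, §4.6] -/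
theorem domArmEvent_mono_dom (r R : ℕ) (hHH' : H ⊆ H') :
    domArmEvent κ r R H ⊆ domArmEvent κ r R H' := by
  rintro ω ⟨x, y, w, hw, hd⟩
  exact ⟨x, y, w, fun j => ⟨(hw j).1, (hw j).2.1, (hw j).2.2.1,
    fun v hv => ⟨((hw j).2.2.2.1 v hv).1, hHH' ((hw j).2.2.2.1 v hv).2⟩, (hw j).2.2.2.2⟩, hd⟩

/-- **Confined arms from paths.** If `T₀, …, T_{k-1}` are pairwise disjoint subsets of the closed
annulus `{r ≤ |·|_𝕋 ≤ R}` inside `H`, the sites of `T_j` having colour `κ j` in `ω`, and each `T_j`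
contains a `𝕋`-path from `∂Λ_r` to `∂Λ_R`, then `ω ∈ domArmEvent κ r R H` (a walk inside `T_j`
contains a self-avoiding one). [cite: Nolin2008, §4.6] -/
theorem mem_domArmEvent_of_pathIn {ω : SiteConfig (Site 2)} (T : Fin k → Set (Site 2))
    (hT : Pairwise fun i j => Disjoint (T i) (T j)) (hcol : ∀ i, ∀ z ∈ T i, (z ∈ ω ↔ κ i = true))
    (hann : ∀ i, ∀ z ∈ T i, (r : ℤ) ≤ triNorm z ∧ triNorm z ≤ R) (hH : ∀ i, T i ⊆ H)
    (hp : ∀ i, ∃ x ∈ triSphere r, ∃ y ∈ triSphere R, PathIn triGraph (T i) x y) :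
    ω ∈ domArmEvent κ r R H := by
  classical
  choose x hx y hy hpath using hp
  have hw : ∀ i, ∃ W : triGraph.Walk (x i) (y i), ∀ z ∈ W.support, z ∈ T i :=
    fun i => (hpath i).exists_walk
  choose W hW using hw
  refine ⟨x, y, fun i => ((W i).toPath : triGraph.Walk (x i) (y i)), fun i => ?_, ?_⟩
  · have hsub : ∀ z ∈ ((W i).toPath : triGraph.Walk (x i) (y i)).support, z ∈ T i :=
      fun z hz => hW i z (SimpleGraph.Walk.support_toPath_subset_support (W i) hz)
    refine ⟨hx i, hy i, (W i).toPath.2, fun z hz => ⟨?_, hH i (hsub z hz)⟩, fun z hz => ?_⟩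
    · obtain ⟨h1, h2⟩ := hann i z (hsub z hz)
      rcases eq_or_lt_of_le h1 with h1 | h1
      · right; rw [mem_triSphere_iff, ← h1]
      · left
        simp only [mem_sdiff, Finset.mem_coe, mem_triBall_iff, not_le]
        exact ⟨h2, h1⟩
    · have := hcol i z (hsub z hz)
      simpa using this
  · intro i j hij
    rw [Finset.disjoint_left]
    intro z hzi hzj
    have hi := hW i z (SimpleGraph.Walk.support_toPath_subset_support (W i) (List.mem_toFinset.1 hzi))
    have hj := hW j z (SimpleGraph.Walk.support_toPath_subset_support (W j) (List.mem_toFinset.1 hzj))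
    exact Set.disjoint_left.1 (hT hij) hi hj

/-- Confined closed arms form a decreasing event. [cite: Nolin2008, §4.3] -/
theorem isLowerSet_domArmEvent (hκ : ∀ j, κ j = false) (r R : ℕ) (H : Set (Site 2)) :
    IsLowerSet (domArmEvent κ r R H) := by
  rintro ω ω' hle ⟨x, y, w, hw, hd⟩
  refine ⟨x, y, w, fun j => ?_, hd⟩
  obtain ⟨hx, hy, hp, hs, hc⟩ := hw j
  refine ⟨hx, hy, hp, hs, fun v hv => ?_⟩
  have hvω : v ∉ ω := by simpa [hκ j] using hc v hv
  have hvω' : v ∉ ω' := fun h => hvω (hle h)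
  simpa [hκ j] using hvω'

/-- Confined open arms form an increasing event. [cite: Nolin2008, §4.3] -/
theorem isUpperSet_domArmEvent (hκ : ∀ j, κ j = true) (r R : ℕ) (H : Set (Site 2)) :
    IsUpperSet (domArmEvent κ r R H) := by
  rintro ω ω' hle ⟨x, y, w, hw, hd⟩
  refine ⟨x, y, w, fun j => ?_, hd⟩
  obtain ⟨hx, hy, hp, hs, hc⟩ := hw j
  refine ⟨hx, hy, hp, hs, fun v hv => ?_⟩
  have hvω : v ∈ ω := by simpa [hκ j] using hc v hv
  simpa [hκ j] using hle hvω

/-- The confined arm event is determined by the sites of the annulus `triAnnulus r R`. [cite: SmirnovWernerMRL2001, §3] -/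
theorem determinedBy_domArmEvent (hrR : r ≤ R) (H : Set (Site 2)) :
    DeterminedBy (domArmEvent κ r R H) ↑(triAnnulus r R) := by
  rw [determinedBy_iff]
  suffices key : ∀ ω ω' : Set (Site 2), ω ∩ ↑(triAnnulus r R) = ω' ∩ ↑(triAnnulus r R) →
      ω ∈ domArmEvent κ r R H → ω' ∈ domArmEvent κ r R H from
    fun ω ω' h => ⟨key ω ω' h, key ω' ω h.symm⟩
  rintro ω ω' h ⟨x, y, w, hw, hd⟩
  refine ⟨x, y, w, fun j => ?_, hd⟩
  obtain ⟨hx, hy, hpath, hsupp, hcol⟩ := hw j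
  refine ⟨hx, hy, hpath, hsupp, fun v hv => ?_⟩
  have hvA : v ∈ (↑(triAnnulus r R) : Set (Site 2)) :=
    Finset.mem_coe.2 (mem_triAnnulus_of_arm hrR (hsupp v hv).1)
  have key := Set.ext_iff.1 h v
  simp only [mem_inter_iff, hvA, and_true] at key
  rw [← hcol v hv, key]

/-- Confined arm events are measurable. [cite: SmirnovWernerMRL2001, §3] -/
theorem measurableSet_domArmEvent (hrR : r ≤ R) (H : Set (Site 2)) :
    MeasurableSet (domArmEvent κ r R H) :=
  (determinedBy_domArmEvent κ hrR H).measurableSet_of_finset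

/-- **Transport of confined arms by the norm-preserving automorphisms of `𝕋`** (pull-back form):
if `φ` is an automorphism of `𝕋` preserving `triNorm` and the relabelled configuration `φ(ξ)` has
arms confined to `φ(H)`, then `ξ` has arms confined to `H` (map the arms by `φ⁻¹`). [cite: SmirnovWernerMRL2001, Rem. 2] -/
theorem mem_domArmEvent_of_relabel_iso (φ : triGraph ≃g triGraph)
    (hφn : ∀ z, triNorm (φ z) = triNorm z) {ξ : SiteConfig (Site 2)}
    (h : SiteConfig.relabel φ.toEquiv ξ ∈ domArmEvent κ r R (φ '' H)) :
    ξ ∈ domArmEvent κ r R H := by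
  classical
  obtain ⟨x, y, w, hw, hdisj⟩ := h
  have hψn : ∀ z, triNorm (φ.symm z) = triNorm z := fun z => by
    have := hφn (φ.symm z); rw [RelIso.apply_symm_apply] at this; exact this.symm
  set f : triGraph →g triGraph := φ.symm.toEmbedding.toHom with hf
  have hfapp : ∀ z, f z = φ.symm z := fun z => rfl
  have hmemξ : ∀ z, z ∈ SiteConfig.relabel φ.toEquiv ξ ↔ φ.symm z ∈ ξ := fun z =>
    SiteConfig.mem_relabel_iff _ _ _
  refine ⟨fun j => φ.symm (x j), fun j => φ.symm (y j), fun j => (w j).map f, fun j => ?_, ?_⟩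
  · obtain ⟨hx, hy, hpath, hsupp, hcol⟩ := hw j
    refine ⟨?_, ?_, hpath.map (f := f) φ.symm.injective, ?_, ?_⟩
    · rw [mem_triSphere_iff, hψn]; exact mem_triSphere_iff.1 hx
    · rw [mem_triSphere_iff, hψn]; exact mem_triSphere_iff.1 hy
    · intro v hv
      rw [SimpleGraph.Walk.support_map, List.mem_map] at hv
      obtain ⟨u, hu, rfl⟩ := hv
      rw [hfapp]
      obtain ⟨hu1, hu2⟩ := hsupp u hu
      refine ⟨?_, ?_⟩
      · rcases hu1 with hu' | hu'
        · left
          simp only [mem_sdiff, Finset.mem_coe, mem_triBall_iff, hψn] at hu' ⊢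
          exact hu'
        · right; rw [mem_triSphere_iff, hψn]; exact mem_triSphere_iff.1 hu'
      · obtain ⟨u', hu', hu'u⟩ := hu2
        rw [← hu'u, RelIso.symm_apply_apply]
        exact hu'
    · intro v hv
      rw [SimpleGraph.Walk.support_map, List.mem_map] at hv
      obtain ⟨u, hu, rfl⟩ := hv
      rw [hfapp, ← hmemξ]
      exact hcol u hu
  · intro i j hij
    rw [Finset.disjoint_left]
    intro v hvi hvj
    rw [List.mem_toFinset, SimpleGraph.Walk.support_map, List.mem_map] at hvi hvj
    obtain ⟨u, hu, rfl⟩ := hvi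
    obtain ⟨u', hu', huu'⟩ := hvj
    rw [hfapp, hfapp] at huu'
    have : u' = u := φ.symm.injective huu'
    subst this
    exact Finset.disjoint_left.1 (hdisj hij) (List.mem_toFinset.2 hu) (List.mem_toFinset.2 hu')

/-- **Transport of confined arms** (`iff` form): the relabelled configuration `φ(ξ)` has arms
confined to `φ(H)` iff `ξ` has arms confined to `H`. [cite: SmirnovWernerMRL2001, Rem. 2] -/
theorem relabel_iso_mem_domArmEvent_iff (φ : triGraph ≃g triGraph)
    (hφn : ∀ z, triNorm (φ z) = triNorm z) (ξ : SiteConfig (Site 2)) :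
    SiteConfig.relabel φ.toEquiv ξ ∈ domArmEvent κ r R (φ '' H) ↔ ξ ∈ domArmEvent κ r R H := by
  refine ⟨mem_domArmEvent_of_relabel_iso κ φ hφn, fun h => ?_⟩
  have hψn : ∀ z, triNorm (φ.symm z) = triNorm z := fun z => by
    have := hφn (φ.symm z); rw [RelIso.apply_symm_apply] at this; exact this.symm
  apply mem_domArmEvent_of_relabel_iso κ φ.symm hψn
  have h1 : SiteConfig.relabel φ.symm.toEquiv (SiteConfig.relabel φ.toEquiv ξ) = ξ := by
    ext z
    rw [SiteConfig.mem_relabel_iff, SiteConfig.mem_relabel_iff]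
    show φ.toEquiv.symm (φ.symm.toEquiv.symm z) ∈ ξ ↔ z ∈ ξ
    rw [show φ.symm.toEquiv.symm z = φ z from rfl, show φ.toEquiv.symm (φ z) = φ.symm (φ z) from rfl,
      RelIso.symm_apply_apply]
  have h2 : φ.symm '' (φ '' H) = H := by
    ext z; simp only [Set.mem_image]
    constructor
    · rintro ⟨_, ⟨u, hu, rfl⟩, rfl⟩; simpa using hu
    · intro hz; exact ⟨φ z, ⟨z, hz, rfl⟩, by simp⟩
  rw [h1, h2]
  exact h

/-- **A domain and its image have the same confined-arm probabilities** under any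
norm-preserving automorphism of `𝕋` (invariance of `P_p` under relabelling). [cite: SmirnovWernerMRL2001, Rem. 2] -/
theorem real_domArmEvent_relabel_iso (p : unitInterval) (φ : triGraph ≃g triGraph)
    (hφn : ∀ z, triNorm (φ z) = triNorm z) (r R : ℕ) (H : Set (Site 2)) :
    (triSitePercolation p).real (domArmEvent κ r R (φ '' H)) =
      (triSitePercolation p).real (domArmEvent κ r R H) := by
  have hset : SiteConfig.relabel φ.toEquiv ⁻¹' domArmEvent κ r R (φ '' H) = domArmEvent κ r R H := by
    ext ξ; exact relabel_iso_mem_domArmEvent_iff κ φ hφn ξ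
  rw [← hset, triSitePercolation]
  exact (sitePercolation_real_preimage_relabel φ.toEquiv p _).symm

end API

/-! ### The universal half-plane two-arm bound at `p = 1/2` (named fact) -/

/-- **The half-plane two-arm probability at criticality is at most `cst · m/n`** (Nolin 2008,
Thm. 24 (i) [arXiv 0711.4948: Thm. 23 (i)]: "For any `σ ∈ 𝔖₂`, `P_{1/2}(B_{2,σ}(0, N)) ≍ N^{-1}`" —
the universal half-plane two-arm exponent `1`, here in the two-radii form
`P_{1/2}(B_{2,σ}(m, n)) ≤ C m/n` which follows from the printed one by the quasi-multiplicativity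
Prop. 17 [arXiv: Prop. 16], valid for half-plane events by §4.6 ("all the results stated here remain
true for arms in the half-plane"); Werner 2009, first exercise sheet, "Two-arm exponent in the
half-plane" (`c₁/n ≤ w_n ≤ c₂/n`); Smirnov–Werner 2001, §4, Thm. 3; originally Kesten 1987). For
every colour pair `κ` (in particular two *closed* arms, the case used near the boundary of
`{0 ↔ ∂Λ_N}` at `p > 1/2`, where the event is decreasing), there are `n₀` and `C` with
`P_{1/2}(domArmEvent κ m n upperHalfPlane) ≤ C · m/n` for `n₀ ≤ m ≤ n` (hexagonal annuli and
the closed upper half-plane of `𝕋`; the linear order of the two arms is not imposed, which for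
`j = 2` only enlarges the event by the pattern `σ` reversed, of the same probability by the
reflection `z₀ ↦ -z₀ - z₁`). Only the upper bound is recorded. [cite: Nolin2008, Thm. 24 (i) with Prop. 17 and §4.6 (arXiv 0711.4948: Thm. 23 (i), Prop. 16)] [cite: WernerPCMI2009, Lecture 2, first exercise sheet ("Two-arm exponent in the half-plane", 3)] -/
def Nolin2008_halfPlane_twoArm : Prop :=
  ∃ n₀ : ℕ, ∃ C : ℝ, ∀ κ : Fin 2 → Bool, ∀ m n : ℕ, n₀ ≤ m → m ≤ n →
    (triSitePercolation half).real (domArmEvent κ m n upperHalfPlane) ≤ C * ((m : ℝ) / n)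

end Literature.Probability.Percolation
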